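import Mathlib
import HarnessLib
import Summits.NavierStokesRegularity.NavierStokesRegularity.Theorems.HalfSpaceWindowDoorCirculationCarryingRigidityGaussExtremalConditions

/-!
# Route `HalfSpaceWindowDoor`, crux `CirculationCarryingRigidity` (stmt-NavierStokesRegularity-25311) —
# the FILAMENT BOUND: the extremal enemy's vertical vorticity is nowhere, at no time and at no scale below the self-similar one, more
# concentrated than a filament of strength `∼ Λ`

LEAD ns-hsw-p1 g8 (cell pub-ns-dss), `--supports stmt-NavierStokesRegularity-25311 --as helper`; sequel of `…GaussExtremalFamily` / `…GaussExtremalJoint`.  The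
moment packages read the scale × axis maximality of the Gaussian-extremal profile `W` only INFINITESIMALLY at `(t, σ, y₀) = (1, −1, 0)`.
GLOBALLY it says `t·Θ^σ(t,y) ≤ Θ^{−1}(1,0) = M₀` for EVERY time `σ < 0`, EVERY scale `0 < t ≤ −σ` and EVERY centre `y`
(`Θ^σ(t,·) = e^{tΔ}ω₃(σ)`, `M₀ = ∫G₁ω₃(−1) = Λ/((4π)^{3/2}·2)`), and since `ω₃ ≥ 0` the caloric mean bounds the mass of balls from above
(`G_t ≥ (4πt)^{−3/2}e^{−r²/4t}` on `B_r`):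

* `ballIntegral_le_heatExtension` — for continuous bounded `f ≥ 0`: `(4πt)^{−3/2}e^{−r²/4t}·∫_{B_r(y)} f ≤ (e^{tΔ}f)(y)`;
* `filament_of_extremal` — for the extremal `W` (raw extremality data of `exists_gaussExtremal'`): for all `σ < 0`, `0 < t ≤ −σ`, `y`, `r > 0`,
  **`∫_{B_r(y)} ω₃(σ) ≤ (4πt)^{3/2}/t · e^{r²/4t} · M₀`**;
* `filament_of_extremal_linear` — the choice `t = r²/2` (admissible when `r² ≤ 2(−σ)`, i.e. up to the self-similar scale):
  **`∫_{B_r(y)} ω₃(σ) ≤ 2(2π)^{3/2}e^{1/2} · r · M₀`** — a UNIFORM ONE-DIMENSIONAL UPPER DENSITY of the measure `ω₃(σ)dx` at every point,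
  every time and every radius below `√(2(−σ))`, in units of the extremal Gaussian mass: vortex FILAMENTS of strength `≲ 52·M₀` are allowed,
  anything more concentrated (sub-filament blobs carrying mass `≫ rM₀` in a ball of radius `r`) is not;
* `gaussExtremal_filament`, `circulationCarryingRigidity_of_filament` — the ∃-form for an enemy of W6 and the reduction of the crux.

WHAT THIS IS NOT: not a statement about Navier–Stokes regularity; door statements concern HYPOTHETICAL blow-up profiles (KNSS ancient
mild solutions).  No item is closed by this file.
-/

noncomputable section

-- the summit and its single sub-problem share the name (CONVENTIONS §1), as in every Theorems file
set_option linter.dupNamespace false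

namespace Summit.NavierStokesRegularity.NavierStokesRegularity.Theorems.HalfSpaceWindowDoorCirculationCarryingRigidityGaussExtremalFilament

open MeasureTheory Set Function Filter Topology Metric
open scoped RealInnerProductSpace InnerProductSpace
open Literature.Analysis Literature.Analysis.FluidPDE Literature.Analysis.UnboundedOperators
open Summit.NavierStokesRegularity.NavierStokesRegularity.Theses.HalfSpaceWindowDoor
open Summit.NavierStokesRegularity.NavierStokesRegularity.Theorems.HalfSpaceWindowDoorCirculationCarryingRigidityDefs
open Summit.NavierStokesRegularity.NavierStokesRegularity.Theorems.HalfSpaceWindowDoorCirculationCarryingRigidityReduction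
  (circulationCarryingRigidity_of_hemisphereLiouvilleE3)
open Summit.NavierStokesRegularity.NavierStokesRegularity.Theorems.HalfSpaceWindowDoorCirculationCarryingRigidityGaussKernel
  (inner_e3_apply)
open Summit.NavierStokesRegularity.NavierStokesRegularity.Theorems.HalfSpaceWindowDoorCirculationCarryingRigidityGaussExtremalConditions
  (gaussAngMom_eq_heatExtension omega3_continuous_bounded heatKernel_sub_comm)
open Summit.NavierStokesRegularity.NavierStokesRegularity.Theorems.HalfSpaceWindowDoorCirculationCarryingRigidityGaussExtremalFamily
  (exists_gaussExtremal')

/-! ### Caloric means bound the mass of balls -/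

/-- **Ball mass under the caloric mean.**  For continuous bounded `f ≥ 0` on `ℝ³`, `t > 0`, `r > 0` and every centre `y`:
`(4πt)^{−3/2}·e^{−r²/(4t)} · ∫_{B_r(y)} f ≤ (e^{tΔ}f)(y)`. -/
theorem ballIntegral_le_heatExtension {f : EuclideanSpace ℝ (Fin 3) → ℝ} (hf : Continuous f) {B : ℝ} (hB : ∀ x, ‖f x‖ ≤ B)
    (hf0 : ∀ x, 0 ≤ f x) {t : ℝ} (ht : 0 < t) (y : EuclideanSpace ℝ (Fin 3)) {r : ℝ} (hr : 0 < r) :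
    (4 * Real.pi * t) ^ (-(3 : ℝ) / 2) * Real.exp (-r ^ 2 / (4 * t)) * ∫ x in ball y r, f x ≤ heatExtension f t y := by
  set m : ℝ := (4 * Real.pi * t) ^ (-(3 : ℝ) / 2) * Real.exp (-r ^ 2 / (4 * t)) with hm
  have hm0 : 0 ≤ m := by positivity
  rw [heatExtension_eq_integral_mul]
  -- integrability of `G_t(y − ·) f`
  have hGc : Continuous fun z : EuclideanSpace ℝ (Fin 3) => heatKernel t (y - z) := by unfold heatKernel; fun_prop
  have hint : Integrable (fun z => heatKernel t (y - z) * f z) := by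
    have h := ((integrable_heatKernel_holds (E := EuclideanSpace ℝ (Fin 3)) ht).comp_sub_left y).bdd_mul hf.aestronglyMeasurable
      (ae_of_all _ fun x => hB x)
    exact h.congr (ae_of_all _ fun x => by simp [mul_comm])
  have hnn : ∀ z, 0 ≤ heatKernel t (y - z) * f z := fun z => mul_nonneg (heatKernel_pos ht _).le (hf0 z)
  -- the kernel on the ball
  have hker : ∀ z ∈ ball y r, m ≤ heatKernel t (y - z) := by
    intro z hz
    rw [hm]
    unfold heatKernel
    rw [finrank_euclideanSpace_fin]
    push_cast
    refine mul_le_mul_of_nonneg_left (Real.exp_le_exp.2 ?_) (by positivity)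
    have hd : ‖y - z‖ < r := by rw [← dist_eq_norm]; exact mem_ball'.1 hz
    have hsq : ‖y - z‖ ^ 2 ≤ r ^ 2 := by
      have := norm_nonneg (y - z); nlinarith
    have h4 : 0 < 4 * t := by positivity
    rw [neg_div, neg_div, neg_le_neg_iff]
    exact div_le_div_of_nonneg_right hsq h4.le
  -- `f` is integrable on the ball
  have hfball : IntegrableOn f (ball y r) := by
    refine Measure.integrableOn_of_bounded (M := B) measure_ball_lt_top.ne hf.aestronglyMeasurable ?_
    exact ae_of_all _ fun x => hB x
  calc m * ∫ x in ball y r, f x = ∫ x in ball y r, m * f x := (integral_const_mul _ _).symm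
    _ ≤ ∫ x in ball y r, heatKernel t (y - x) * f x := by
        refine setIntegral_mono_on (hfball.const_mul m) hint.integrableOn measurableSet_ball fun z hz => ?_
        exact mul_le_mul_of_nonneg_right (hker z hz) (hf0 z)
    _ ≤ ∫ x, heatKernel t (y - x) * f x := setIntegral_le_integral hint (ae_of_all _ hnn)

/-! ### The filament bound for the extremal profile -/

variable {C : ℝ} {W : ℝ → EuclideanSpace ℝ (Fin 3) → EuclideanSpace ℝ (Fin 3)}

/-- **FILAMENT BOUND (every time, every centre, every scale up to the apex).**  For a closed-hemisphere door-class `W` which is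
Gaussian-extremal (`𝒢(t;y)[W(σ)] ≤ 𝒢(1;0)[W(−1)]` for all `σ < 0`, `0 < t ≤ −σ`, `y`), with `M₀ = ∫G₁ω₃(−1)`:
`∫_{B_r(y)} ω₃(σ) ≤ (4πt)^{3/2}/t · e^{r²/(4t)} · M₀` for all `σ < 0`, `0 < t ≤ −σ`, `y`, `r > 0`. -/
theorem filament_of_extremal (hW : InDoorClass C W) (hWs : SignE3 W)
    (hmax : ∀ σ < 0, ∀ t : ℝ, 0 < t → t ≤ -σ → ∀ y₀, gaussAngMom t y₀ (W σ) ≤ gaussAngMom 1 0 (W (-1)))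
    {σ : ℝ} (hσ : σ < 0) {t : ℝ} (ht : 0 < t) (htσ : t ≤ -σ) (y : EuclideanSpace ℝ (Fin 3)) {r : ℝ} (hr : 0 < r) :
    ∫ x in ball y r, curl (W σ) x 2 ≤
      (4 * Real.pi * t) ^ ((3 : ℝ) / 2) / t * Real.exp (r ^ 2 / (4 * t)) * ∫ x, heatKernel 1 x * curl (W (-1)) x 2 := by
  have hm1 : (-1 : ℝ) < 0 := by norm_num
  set c : ℝ := (4 * Real.pi) ^ ((3 : ℝ) / 2) * 2 with hc
  have hc0 : 0 < c := by positivity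
  -- `t Θ^σ(t,y) ≤ Θ^{-1}(1,0)`
  have h := hmax σ hσ t ht htσ y
  rw [gaussAngMom_eq_heatExtension hW hσ ht y, gaussAngMom_eq_heatExtension hW hm1 one_pos 0] at h
  have h' : t * heatExtension (fun x => ⟪curl (W σ) x, e3⟫) t y ≤ heatExtension (fun x => ⟪curl (W (-1)) x, e3⟫) 1 0 := by
    have h2 : c * (t * heatExtension (fun x => ⟪curl (W σ) x, e3⟫) t y) ≤ c * (1 * heatExtension (fun x => ⟪curl (W (-1)) x, e3⟫) 1 0) := by
      rw [hc]; linarith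
    have h3 := le_of_mul_le_mul_left h2 hc0
    rwa [one_mul] at h3
  -- `Θ^{-1}(1,0) = M₀` in the component spelling
  obtain ⟨hωc1, B1, hωB1⟩ := omega3_continuous_bounded hW hm1
  have hΘ : heatExtension (fun x => ⟪curl (W (-1)) x, e3⟫) 1 0 = ∫ x, heatKernel 1 x * curl (W (-1)) x 2 := by
    rw [heatExtension_eq_integral_mul]
    congr 1; funext z; rw [heatKernel_sub_comm, sub_zero, inner_e3_apply]
  -- the ball bound at time `σ`
  obtain ⟨hωc, B, hωB⟩ := omega3_continuous_bounded hW hσ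
  have hω0 : ∀ x, 0 ≤ ⟪curl (W σ) x, e3⟫ := fun x => hWs σ hσ x
  have hball := ballIntegral_le_heatExtension hωc hωB hω0 ht y hr
  have hcomp : (fun x => ⟪curl (W σ) x, e3⟫) = fun x => curl (W σ) x 2 := by funext x; rw [inner_e3_apply]
  rw [hcomp] at hball
  simp only [hcomp] at h'
  rw [hΘ] at h'
  -- assemble: `m · ∫_B ≤ Θ ≤ M₀/t`
  set I : ℝ := ∫ x in ball y r, curl (W σ) x 2 with hI
  set M₀ : ℝ := ∫ x, heatKernel 1 x * curl (W (-1)) x 2 with hM₀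
  have hpos : 0 < (4 * Real.pi * t) ^ (-(3 : ℝ) / 2) * Real.exp (-r ^ 2 / (4 * t)) := by positivity
  have hstep : (4 * Real.pi * t) ^ (-(3 : ℝ) / 2) * Real.exp (-r ^ 2 / (4 * t)) * I * t ≤ M₀ := by
    calc (4 * Real.pi * t) ^ (-(3 : ℝ) / 2) * Real.exp (-r ^ 2 / (4 * t)) * I * t
        ≤ heatExtension (fun x => curl (W σ) x 2) t y * t := mul_le_mul_of_nonneg_right hball ht.le
      _ = t * heatExtension (fun x => curl (W σ) x 2) t y := mul_comm _ _
      _ ≤ M₀ := h'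
  -- invert the explicit positive factor
  have hinv : (4 * Real.pi * t) ^ ((3 : ℝ) / 2) / t * Real.exp (r ^ 2 / (4 * t)) *
      ((4 * Real.pi * t) ^ (-(3 : ℝ) / 2) * Real.exp (-r ^ 2 / (4 * t)) * I * t) =  I := by
    have h4 : 0 < 4 * Real.pi * t := by positivity
    have hrpow : (4 * Real.pi * t) ^ ((3 : ℝ) / 2) * (4 * Real.pi * t) ^ (-(3 : ℝ) / 2) = 1 := by
      rw [← Real.rpow_add h4]; norm_num
    have hexp : Real.exp (r ^ 2 / (4 * t)) * Real.exp (-r ^ 2 / (4 * t)) = 1 := by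
      rw [← Real.exp_add]; rw [show r ^ 2 / (4 * t) + -r ^ 2 / (4 * t) = 0 by ring, Real.exp_zero]
    have ht0 : t ≠ 0 := ht.ne'
    calc (4 * Real.pi * t) ^ ((3 : ℝ) / 2) / t * Real.exp (r ^ 2 / (4 * t)) *
          ((4 * Real.pi * t) ^ (-(3 : ℝ) / 2) * Real.exp (-r ^ 2 / (4 * t)) * I * t)
        = ((4 * Real.pi * t) ^ ((3 : ℝ) / 2) * (4 * Real.pi * t) ^ (-(3 : ℝ) / 2)) *
            (Real.exp (r ^ 2 / (4 * t)) * Real.exp (-r ^ 2 / (4 * t))) * I * (t / t) := by ring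
      _ = I := by rw [hrpow, hexp, div_self ht0]; ring
  have hfac : 0 ≤ (4 * Real.pi * t) ^ ((3 : ℝ) / 2) / t * Real.exp (r ^ 2 / (4 * t)) := by positivity
  calc I = (4 * Real.pi * t) ^ ((3 : ℝ) / 2) / t * Real.exp (r ^ 2 / (4 * t)) *
        ((4 * Real.pi * t) ^ (-(3 : ℝ) / 2) * Real.exp (-r ^ 2 / (4 * t)) * I * t) := hinv.symm
    _ ≤ (4 * Real.pi * t) ^ ((3 : ℝ) / 2) / t * Real.exp (r ^ 2 / (4 * t)) * M₀ := mul_le_mul_of_nonneg_left hstep hfac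


/-- The scale algebra of the choice `t = r²/2`: `(4π·r²/2)^{3/2}/(r²/2)·e^{r²/(4·r²/2)} = 2(2π)^{3/2}e^{1/2}·r`. -/
theorem filament_constant_eq {r : ℝ} (hr : 0 < r) :
    (4 * Real.pi * (r ^ 2 / 2)) ^ ((3 : ℝ) / 2) / (r ^ 2 / 2) * Real.exp (r ^ 2 / (4 * (r ^ 2 / 2))) =
      2 * (2 * Real.pi) ^ ((3 : ℝ) / 2) * Real.exp (1 / 2) * r := by
  have hr0 : r ≠ 0 := hr.ne'
  have h1 : 4 * Real.pi * (r ^ 2 / 2) = (2 * Real.pi) * r ^ 2 := by ring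
  have h2 : ((2 * Real.pi) * r ^ 2) ^ ((3 : ℝ) / 2) = (2 * Real.pi) ^ ((3 : ℝ) / 2) * r ^ 3 := by
    rw [Real.mul_rpow (by positivity) (by positivity)]
    congr 1
    rw [show r ^ 2 = r ^ (2 : ℝ) by norm_cast, ← Real.rpow_mul hr.le]
    norm_num
  have h3 : r ^ 2 / (4 * (r ^ 2 / 2)) = 1 / 2 := by field_simp; ring
  rw [h1, h2, h3]
  field_simp

/-- **FILAMENT BOUND, linear form.**  At every time `σ < 0`, every centre `y` and every radius `0 < r ≤ √(2(−σ))` (up to the self-similar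
scale): `∫_{B_r(y)} ω₃(σ) ≤ 2(2π)^{3/2}e^{1/2} · r · M₀` — a uniform one-dimensional upper density in units of `M₀ = ∫G₁ω₃(−1)`. -/
theorem filament_of_extremal_linear (hW : InDoorClass C W) (hWs : SignE3 W)
    (hmax : ∀ σ < 0, ∀ t : ℝ, 0 < t → t ≤ -σ → ∀ y₀, gaussAngMom t y₀ (W σ) ≤ gaussAngMom 1 0 (W (-1)))
    {σ : ℝ} (hσ : σ < 0) (y : EuclideanSpace ℝ (Fin 3)) {r : ℝ} (hr : 0 < r) (hrσ : r ^ 2 ≤ 2 * (-σ)) :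
    ∫ x in ball y r, curl (W σ) x 2 ≤ 2 * (2 * Real.pi) ^ ((3 : ℝ) / 2) * Real.exp (1 / 2) * r * ∫ x, heatKernel 1 x * curl (W (-1)) x 2 := by
  have ht : 0 < r ^ 2 / 2 := by positivity
  have htσ : r ^ 2 / 2 ≤ -σ := by linarith
  have h := filament_of_extremal hW hWs hmax hσ ht htσ y hr
  rwa [filament_constant_eq hr] at h

/-! ### For an enemy of W6, and the reduction of the crux -/

/-- **THE EXTREMAL ENEMY IS AT MOST FILAMENTARY.**  If some closed-hemisphere door-class profile (constant `C`) has `⟪curl v(s₁)(y₁), e₃⟫ > 0`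
somewhere, there is a closed-hemisphere door-class `W` (constant `C`) with `M₀ = ∫G₁ω₃(−1) > 0` whose vertical vorticity obeys, at EVERY
time `σ < 0`: `∫_{B_r(y)} ω₃(σ) ≤ (4πt)^{3/2}/t·e^{r²/4t}·M₀` for all `0 < t ≤ −σ`, `y`, `r > 0`, and in particular
`∫_{B_r(y)} ω₃(σ) ≤ 2(2π)^{3/2}e^{1/2}·r·M₀` for all `y` and `0 < r`, `r² ≤ 2(−σ)`. -/
theorem gaussExtremal_filament {v : ℝ → EuclideanSpace ℝ (Fin 3) → EuclideanSpace ℝ (Fin 3)} (hv : InDoorClass C v)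
    (hsign : SignE3 v) (hpos : ∃ s < 0, ∃ y, 0 < ⟪curl (v s) y, e3⟫) :
    ∃ W : ℝ → EuclideanSpace ℝ (Fin 3) → EuclideanSpace ℝ (Fin 3), InDoorClass C W ∧ SignE3 W ∧
      0 < ∫ x, heatKernel 1 x * curl (W (-1)) x 2 ∧
      (∀ σ < 0, ∀ t : ℝ, 0 < t → t ≤ -σ → ∀ y (r : ℝ), 0 < r →
        ∫ x in ball y r, curl (W σ) x 2 ≤
          (4 * Real.pi * t) ^ ((3 : ℝ) / 2) / t * Real.exp (r ^ 2 / (4 * t)) * ∫ x, heatKernel 1 x * curl (W (-1)) x 2) ∧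
      (∀ σ < 0, ∀ y (r : ℝ), 0 < r → r ^ 2 ≤ 2 * (-σ) →
        ∫ x in ball y r, curl (W σ) x 2 ≤
          2 * (2 * Real.pi) ^ ((3 : ℝ) / 2) * Real.exp (1 / 2) * r * ∫ x, heatKernel 1 x * curl (W (-1)) x 2) := by
  obtain ⟨W, hW, hWs, hΛ, hmax, -⟩ := exists_gaussExtremal' hv hsign hpos
  have hm1 : (-1 : ℝ) < 0 := by norm_num
  have hM₀ : 0 < ∫ x, heatKernel 1 x * curl (W (-1)) x 2 := by
    have h := hΛ
    rw [gaussAngMom_eq_heatExtension hW hm1 one_pos 0, heatExtension_eq_integral_mul] at h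
    have hc : 0 < (4 * Real.pi) ^ ((3 : ℝ) / 2) * (2 * 1) := by positivity
    have h' := (mul_pos_iff_of_pos_left hc).1 h
    have heq : (fun z => heatKernel 1 (0 - z) * ⟪curl (W (-1)) z, e3⟫) = fun z => heatKernel 1 z * curl (W (-1)) z 2 := by
      funext z; rw [heatKernel_sub_comm, sub_zero, inner_e3_apply]
    rwa [heq] at h'
  exact ⟨W, hW, hWs, hM₀, fun σ hσ t ht htσ y r hr => filament_of_extremal hW hWs hmax hσ ht htσ y hr,
    fun σ hσ y r hr hrσ => filament_of_extremal_linear hW hWs hmax hσ y hr hrσ⟩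

/-- **The crux from the filament bound** (composition with the landed plumbing `stub_rotate`): it suffices to rule out closed-hemisphere
door-class profiles with `M₀ > 0` whose vertical vorticity has the uniform one-dimensional upper density `2(2π)^{3/2}e^{1/2}·M₀` at all
times, centres and radii `r ≤ √(2(−σ))`. -/
theorem circulationCarryingRigidity_of_filament
    (h : ∀ (C : ℝ) (W : ℝ → EuclideanSpace ℝ (Fin 3) → EuclideanSpace ℝ (Fin 3)), InDoorClass C W → SignE3 W →
      0 < ∫ x, heatKernel 1 x * curl (W (-1)) x 2 →
      (∀ σ < 0, ∀ y (r : ℝ), 0 < r → r ^ 2 ≤ 2 * (-σ) →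
        ∫ x in ball y r, curl (W σ) x 2 ≤
          2 * (2 * Real.pi) ^ ((3 : ℝ) / 2) * Real.exp (1 / 2) * r * ∫ x, heatKernel 1 x * curl (W (-1)) x 2) → False) :
    CirculationCarryingRigidity := by
  refine circulationCarryingRigidity_of_hemisphereLiouvilleE3 ?_
  intro C v hrate hcont hmild hdiv hsign s hs y
  by_contra hne
  have hpos : 0 < ⟪curl (v s) y, e3⟫ := lt_of_le_of_ne (hsign s hs y) (Ne.symm hne)
  obtain ⟨W, hW, hWs, h0, -, h1⟩ := gaussExtremal_filament (C := C) ⟨hrate, hcont, hmild, hdiv⟩ hsign ⟨s, hs, y, hpos⟩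
  exact h C W hW hWs h0 h1

end Summit.NavierStokesRegularity.NavierStokesRegularity.Theorems.HalfSpaceWindowDoorCirculationCarryingRigidityGaussExtremalFilament

end
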